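import Summits.Ventures.HSemireg.TwelvefoldDoor
import Summits.Ventures.HSemireg.BlochSpreadUnconditional
import Literature.AlgebraicGeometry.HodgeTheory.BlochSemiregularSpreadFromSubscheme
import Literature.AlgebraicGeometry.HodgeTheory.BlochSemiregularSpreadSmoothComponentsOfSubscheme
import Literature.AlgebraicGeometry.HodgeTheory.ComplexOrientationDegreeFormulaHolds
import HarnessLib

/-!
# Venture HSemireg — bridge (B1) at the S4 RUNG `n = 6`: the three lci doors of `TwelvefoldDoor.lean` on ONE refereed
# Bloch fact, and the integral lci door on the two OBJECT-level printed facts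

HONEST FRAMING. Lean index of the computation cell `pub-hsemireg`, track «S4-PUSH» (iii), seat s4-bridge-1 (bridge (B1)
«VHC-instance ⇒ whole-component algebraicity»). NOTHING about any explicit variety is asserted; NO object is claimed to
exist; every published input is a hypothesis BY NAME; nothing here says that HC, HC_CM or HC_AV is proved. THEOREMS ONLY
(one-line compositions of tree theorems): no `def`, no named fact, no `sorry`, no new axiom.

`TwelvefoldDoor.lean` §3 types three lci doors at the S4 rung, each on ITS class-level rendering of Bloch's semiregularity
theorem (7.4) as a refereed named fact: the integral door on `BlochSemiregularSpread 12 6`, the any-lci door on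
`BlochSemiregularSpreadOfSubscheme 12 6`, the reduced-union door on `BlochSemiregularSpreadSmoothComponents 12 6`. The tree
PROVES that the second rendering implies the other two — `blochSemiregularSpread_of_subscheme`
(`BlochSemiregularSpreadFromSubscheme.lean`) and `blochSemiregularSpreadSmoothComponents_of_subscheme`
(`BlochSemiregularSpreadSmoothComponentsOfSubscheme.lean`, granted Fulton's degree formula for the complex orientations,
itself a tree theorem `Fulton1998_degreeFormula_complexOrientation_holds`) — and that the first rendering follows from the two
OBJECT-level printed facts ALONE — `Bloch1972.blochSemiregularSpread_of_blochLifts_of_fulton` (`BlochSpreadUnconditional.lean`: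
Bloch 1972 Thm. (7.1) + Hilbert point + Artin = `Bloch1972_semiregularSubschemeLifts`; Fulton Cor. 10.1 / 19.2 =
`fulton1998_flatFamily_cycleClass_specialises`). Hence, at the S4 rung:

* `weilTwelvefoldsSplit_and_below_of_blochSpreadOfSubscheme_of_hyperbolicBlochSeed_six` — the INTEGRAL lci door on the any-lci fact;
* `weilTwelvefoldsSplit_and_below_of_blochSpreadOfSubscheme_of_unionSeedAt_six` — the REDUCED-UNION door on the any-lci fact;
* `weilTwelvefoldsSplit_and_below_of_blochLifts_of_fulton_of_hyperbolicBlochSeed_six` — the INTEGRAL lci door on the two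
  object-level printed facts (the finest provenance the tree holds for the lci door).

Net effect for the trust base of (B1) at the rung (`B1-TYPING-bridge-1.md` §2 (a)): the three lci doors take ONE printed theorem BY
NAME (`BlochSemiregularSpreadOfSubscheme 12 6`, Bloch (7.1)/(7.4) for any lci, class `= subschemeClass`), or — integral seeds —
the two object-level facts; plus the reach `weilFamilyReach_hyperbolic` and the SEED (the S4 object, NOT claimed). CLOSEDNESS is a
tree theorem throughout (`charlesSchnell_algebraicityLocus_iUnion_closed_holds`).

References: [Bloch1972Semiregularity] Thm. (7.1), Thm. (7.4), proof p. 65, Remark (7.5); [Fulton1998] §1.5, §10.1 Cor. 10.1,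
Lemma 19.1.2, §19.2 Cor. 19.2 (b); [Deligne1982HodgeCycles] proof of Thm. 4.8; [Schoen1998HodgeWeilAddendum] 10 (Proposition),
p. 332; [CharlesSchnell2014Notes] Prop. 11.3.11 (proof).
-/

noncomputable section

open CategoryTheory AlgebraicGeometry

namespace Summit.Ventures.HSemireg
open Literature.AlgebraicGeometry Literature.AlgebraicGeometry.Motives
open Literature.AlgebraicGeometry.HodgeTheory
open Literature.AlgebraicTopology.SingularHomology
open Summit.HodgeConjecture.HodgeConjecture
open Summit.HodgeConjecture.HodgeConjecture.WeilTypeLadder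
open Summit.HodgeConjecture.HodgeConjecture.Cruxes.HodgeAbelianVarieties.EStepSecantInduction
open Summit.Ventures.HSemireg.GeneralStructure

/-- **Integral lci door at the S4 rung on the ANY-lci fact**: `BlochSemiregularSpreadOfSubscheme 12 6` (Bloch (7.1)/(7.4) for any
lci subscheme, class `= subschemeClass`; refereed named fact) ∧ reach ∧ ONE hyperbolic Bloch seed `HasHyperbolicBlochSeed 6 d` ⟹
every split `√-d`-Weil twelvefold and `WeilAlgebraicAll 5 d ∧ 4 ∧ 3 ∧ 2` (`TwelvefoldDoor`'s integral door fed by the tree theorem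
`blochSemiregularSpread_of_subscheme`). [cite: Bloch1972Semiregularity, Thm. (7.4) and Remark (7.5), p. 65]
[cite: Deligne1982HodgeCycles, proof of Thm. 4.8] [cite: Schoen1998HodgeWeilAddendum, 10 (Proposition), p. 332] -/
theorem weilTwelvefoldsSplit_and_below_of_blochSpreadOfSubscheme_of_hyperbolicBlochSeed_six
    (hB : BlochSemiregularSpreadOfSubscheme (2 * 6) 6) (hF : weilFamilyReach_hyperbolic) {d : ℕ} (hd : 0 < d)
    (hS : HasHyperbolicBlochSeed 6 d) :
    Stubs.WeilAlgebraicSplitHyperplane 6 d ∧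
      (WeilAlgebraicAll 5 d ∧ WeilAlgebraicAll 4 d ∧ WeilAlgebraicAll 3 d ∧ WeilAlgebraicAll 2 d) :=
  weilTwelvefoldsSplit_and_below_of_blochSpread_of_hyperbolicBlochSeed_six (blochSemiregularSpread_of_subscheme hB) hF hd hS

/-- **Reduced lci UNION door at the S4 rung on the ANY-lci fact**: `BlochSemiregularSpreadOfSubscheme 12 6` ∧ reach ∧ a hyperbolic
anchor of dimension `12` with a non-zero rational Weil class `w` and a union seed `HasBlochUnionSeedAt 6 P h_K w` ⟹ every split
`√-d`-Weil twelvefold and `WeilAlgebraicAll 5 d ∧ 4 ∧ 3 ∧ 2` (`TwelvefoldDoor`'s union door fed by the tree theorems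
`blochSemiregularSpreadSmoothComponents_of_subscheme` and `Fulton1998_degreeFormula_complexOrientation_holds`).
[cite: Bloch1972Semiregularity, Thm. (7.4) and Remark (7.5)] [cite: Fulton1998, §1.5 and Lemma 19.1.2]
[cite: Deligne1982HodgeCycles, proof of Thm. 4.8] [cite: Schoen1998HodgeWeilAddendum, 10 (Proposition), p. 332] -/
theorem weilTwelvefoldsSplit_and_below_of_blochSpreadOfSubscheme_of_unionSeedAt_six
    (hB : BlochSemiregularSpreadOfSubscheme (2 * 6) 6) (hF : weilFamilyReach_hyperbolic) {d : ℕ} (hd : 0 < d)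
    (P : AbelianVariety ℂ) (ψ₀ : P ⟶ P) (ι : ProjectiveEmbedding P.X) (a : complexBetti (projectiveSpace ι.n ℂ) 2)
    (w : complexBetti P.X (2 * 6)) (hP : P.dim = 2 * 6) (hψ : ψ₀ ≫ ψ₀ = -(d • 𝟙 P)) (ha : IsRationalClass a)
    (ha0 : a ≠ 0) (hhyp : IsHyperbolicWeilType P ψ₀ 6 (symmetrisedClass d P ψ₀ ι a))
    (hwW : w ∈ weilClassesOf P ψ₀ 6 d) (hwr : IsRationalClass w) (hw0 : w ≠ 0)
    (hS : HasBlochUnionSeedAt 6 P (symmetrisedClass d P ψ₀ ι a) w) :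
    Stubs.WeilAlgebraicSplitHyperplane 6 d ∧
      (WeilAlgebraicAll 5 d ∧ WeilAlgebraicAll 4 d ∧ WeilAlgebraicAll 3 d ∧ WeilAlgebraicAll 2 d) :=
  weilTwelvefoldsSplit_and_below_of_blochSpreadSmoothComponents_of_unionSeedAt_six
    (blochSemiregularSpreadSmoothComponents_of_subscheme Fulton1998_degreeFormula_complexOrientation_holds hB)
    hF hd P ψ₀ ι a w hP hψ ha ha0 hhyp hwW hwr hw0 hS

/-- **Integral lci door at the S4 rung on the two OBJECT-level printed facts**: Bloch 1972 Thm. (7.1) + Hilbert point + Artin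
(`Bloch1972_semiregularSubschemeLifts`) ∧ Fulton Cor. 10.1 / 19.2 (`fulton1998_flatFamily_cycleClass_specialises`) ∧ reach ∧ ONE
hyperbolic Bloch seed `HasHyperbolicBlochSeed 6 d` ⟹ every split `√-d`-Weil twelvefold and `WeilAlgebraicAll 5 d ∧ 4 ∧ 3 ∧ 2`
(`TwelvefoldDoor`'s integral door fed by `Bloch1972.blochSemiregularSpread_of_blochLifts_of_fulton`, the (T)-closed capstone of
`BlochSpreadUnconditional.lean`). [cite: Bloch1972Semiregularity, Thm. (7.1) p. 64 and Thm. (7.4) with Remark (7.5) p. 65]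
[cite: Fulton1998, §10.1 Cor. 10.1; §19.2 Cor. 19.2 (b)] [cite: Deligne1982HodgeCycles, proof of Thm. 4.8]
[cite: Schoen1998HodgeWeilAddendum, 10 (Proposition), p. 332] -/
theorem weilTwelvefoldsSplit_and_below_of_blochLifts_of_fulton_of_hyperbolicBlochSeed_six
    (hBl : Bloch1972_semiregularSubschemeLifts) (hFu : fulton1998_flatFamily_cycleClass_specialises)
    (hF : weilFamilyReach_hyperbolic) {d : ℕ} (hd : 0 < d) (hS : HasHyperbolicBlochSeed 6 d) :
    Stubs.WeilAlgebraicSplitHyperplane 6 d ∧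
      (WeilAlgebraicAll 5 d ∧ WeilAlgebraicAll 4 d ∧ WeilAlgebraicAll 3 d ∧ WeilAlgebraicAll 2 d) :=
  weilTwelvefoldsSplit_and_below_of_blochSpread_of_hyperbolicBlochSeed_six
    (Bloch1972.blochSemiregularSpread_of_blochLifts_of_fulton (2 * 6) 6 hBl hFu) hF hd hS

end Summit.Ventures.HSemireg

end
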